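import Mathlib
import HarnessLib
import Summits.NavierStokesRegularity.NavierStokesRegularity.Theorems.TaylorModelRungThreeCertificateIntervalDJetsArrayVD

/-!
# Crux K1b-DR (stmt-NavierStokesRegularity-23954), line `taylor-model` — certificate SOUNDNESS tooling: INTERVAL JETS, part 7 —
# variational jets through a LINEARISED symmetric field twin, shared by all direction columns (the `W_k(H²)` matrix of
# PROPAGATE-V-SPEC-cert1 §2 C, the dominant cost of the v3 sub-step)

The variational recursion `(k+1)·U_{k+1} = Σ_{i≤k} (Q (T_i) U_{k-i} + Q U_{k-i} (T_i))` reads the field only through the SYMMETRISED LINEAR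
maps `v ↦ Q (T_i) v + Q v (T_i)`. When the same state levels serve many direction columns (the `n` columns of the one-step variational
matrix), it pays to LINEARISE each state level once — an operator table `op : Array (List (ℕ × IntervalD))` (per target coordinate a list of
`(source coordinate, coefficient box)`) applied to a column by `applyLinA` — and to run every column against the shared tables. Abstract
layer: `IsSymFieldEnclosure rd Q QS` (a twin of the symmetrised bilinear map), `varJetStepS` / `IsVarJetEnclosureS` /
`mem_varJet_of_isVarJetEnclosureS` (as part 1's variational theorem, one twin call per `m`). Array layer: `applyLinA`, `IsLinSymEnclosureA rd Q n
mkOp` (the linearisation `mkOp A` of a state box encloses `Q u w + Q w u` for `u ∈ A`), `opsOf mkOp Ls K` (the tables of the state levels,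
built ONCE), the per-column levels `wColLevelsA n prec ops D K` (part 2's `buildLevels`), the structural `isVarJetEnclosureS_wColLevelsA` and
**`mem_varJet_of_wColLevelsA`**: `rd (U y v k) c ∈ (wColLevelsA n prec (opsOf mkOp (jetLevelsA …) K) D K)[k][c]` for `y` in `Y`, `v` in `D`.
The matrix form `wMatLevelsA` maps this over an array of direction columns with the tables shared.

MODEL-lattice bookkeeping only (rung TL-M3, one finite-dimensional model ODE); nothing here concerns the Navier–Stokes equations.
-/

-- the sub-problem namespace repeats the summit name by design (D-0017)
set_option linter.dupNamespace false

namespace Summit.NavierStokesRegularity.NavierStokesRegularity.Theorems.TaylorModelCert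

open scoped BigOperators

namespace IntervalD

/-! ### Abstract: variational jets through a symmetrised twin -/

section Sym

variable {V : Type*} {σ : Type*} (rd : V → σ → ℝ) (Q : V → V → V) {T : V → ℕ → V} {U : V → V → ℕ → V}

/-- `QS` is an interval extension of the SYMMETRISED bilinear map `(u, w) ↦ Q u w + Q w u` (coordinatewise through `rd`). [folklore] -/
def IsSymFieldEnclosure (QS : (σ → IntervalD) → (σ → IntervalD) → σ → IntervalD) : Prop :=
  ∀ (A W : σ → IntervalD) (u w : V), (∀ c, mem (rd u c) (A c)) → (∀ c, mem (rd w c) (W c)) →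
    ∀ c, mem (rd (Q u w) c + rd (Q w u) c) (QS A W c)

/-- The rounded interval evaluation of the variational recursion through a symmetrised twin: `(Σ_{m≤k} QS (J m) (JU (k-m)) c) / (k+1)`.
[folklore] -/
def varJetStepS (QS : (σ → IntervalD) → (σ → IntervalD) → σ → IntervalD) (prec : ℕ) (J JU : ℕ → σ → IntervalD) (k : ℕ) (c : σ) :
    IntervalD :=
  divNat prec (rangeSumR prec (fun m => QS (J m) (JU (k - m)) c) (k + 1)) (k + 1)

/-- `JU` is a variational jet enclosure along `J` for the symmetrised step. [folklore] -/
def IsVarJetEnclosureS (QS : (σ → IntervalD) → (σ → IntervalD) → σ → IntervalD) (prec K : ℕ) (J JU : ℕ → σ → IntervalD) : Prop :=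
  ∀ k < K, ∀ (c : σ) (x : ℝ), mem x (varJetStepS QS prec J JU k c) → mem x (JU (k + 1) c)

variable {rd Q}

/-- **Variational jets through a symmetrised twin**: as `mem_varJet_of_isVarJetEnclosure`, with the two field calls per `m` replaced by
one call of a twin of `Q u w + Q w u`. [folklore] -/
theorem mem_varJet_of_isVarJetEnclosureS (hT0 : ∀ x c, rd (T x 0) c = rd x c)
    (hTs : ∀ x (k : ℕ) c, ((k : ℝ) + 1) * rd (T x (k + 1)) c =
      ∑ i ∈ Finset.range (k + 1), rd (Q (T x i) (T x (k - i))) c)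
    (hU0 : ∀ x v c, rd (U x v 0) c = rd v c)
    (hUs : ∀ x v (k : ℕ) c, ((k : ℝ) + 1) * rd (U x v (k + 1)) c =
      ∑ i ∈ Finset.range (k + 1), (rd (Q (T x i) (U x v (k - i))) c + rd (Q (U x v (k - i)) (T x i)) c))
    {QB : (σ → IntervalD) → (σ → IntervalD) → σ → IntervalD} (hQB : IsFieldEnclosure rd Q QB)
    {QS : (σ → IntervalD) → (σ → IntervalD) → σ → IntervalD} (hQS : IsSymFieldEnclosure rd Q QS)
    {prec K : ℕ} {J JU : ℕ → σ → IntervalD} (hJ : IsJetEnclosure QB prec K J) (hJU : IsVarJetEnclosureS QS prec K J JU)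
    {y v : V} (hy : ∀ c, mem (rd y c) (J 0 c)) (hv : ∀ c, mem (rd v c) (JU 0 c)) :
    ∀ k ≤ K, ∀ c, mem (rd (U y v k) c) (JU k c) := by
  have hT := mem_jet_of_isJetEnclosure hT0 hTs hQB hJ hy
  intro k
  induction k using Nat.strong_induction_on with
  | _ k ih =>
    intro hk c
    cases k with
    | zero => rw [hU0]; exact hv c
    | succ k =>
      have hlev : ∀ m ≤ k, ∀ c, mem (rd (U y v m) c) (JU m c) := fun m hm c =>
        ih m (Nat.lt_succ_of_le hm) (le_trans (Nat.le_succ_of_le hm) hk) c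
      have hrec : rd (U y v (k + 1)) c = (∑ i ∈ Finset.range (k + 1),
          (rd (Q (T y i) (U y v (k - i))) c + rd (Q (U y v (k - i)) (T y i)) c)) / ((k + 1 : ℕ) : ℝ) := by
        rw [eq_div_iff (by positivity), ← hUs y v k c]; push_cast; ring
      rw [hrec]
      refine hJU k (Nat.lt_of_succ_le hk) c _ ?_
      refine mem_divNat prec (mem_rangeSumR prec (k + 1) fun m hm => ?_) (Nat.succ_pos k)
      exact hQS (J m) (JU (k - m)) (T y m) (U y v (k - m)) (hT m (le_trans (Nat.le_of_lt_succ hm) ((Nat.le_succ k).trans hk)))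
        (hlev (k - m) (Nat.sub_le k m)) c

end Sym

/-! ### Arrays: linearised operator tables and the per-column levels -/

/-- Reader of an operator table (junk `[]`). [folklore] -/
def oget (op : Array (List (ℕ × IntervalD))) (c : ℕ) : List (ℕ × IntervalD) := if h : c < op.size then op[c] else []

/-- Apply a linearised operator table to a column: coordinate `c < n` is the rounded fold `Σ_(i, B) ∈ op[c]  B · V[i]`. [folklore] -/
def applyLinA (n prec : ℕ) (op : Array (List (ℕ × IntervalD))) (W : Array IntervalD) : Array IntervalD :=
  Array.ofFn fun c : Fin n => (oget op c).foldl (fun acc e => addR prec acc (mulR prec e.2 (aget W e.1))) (ofInt 0)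

/-- The operator tables of the state levels `0..K` (built ONCE, shared by every direction column). [folklore] -/
def opsOf (mkOp : Array IntervalD → Array (List (ℕ × IntervalD))) (Ls : Array (Array IntervalD)) (K : ℕ) :
    Array (Array (List (ℕ × IntervalD))) :=
  Array.ofFn fun m : Fin (K + 1) => mkOp (lget Ls m)

/-- Reader of the tables (junk `#[]`). [folklore] -/
def pget (ops : Array (Array (List (ℕ × IntervalD)))) (m : ℕ) : Array (List (ℕ × IntervalD)) := if h : m < ops.size then ops[m] else #[]

/-- The per-column VARIATIONAL STEP through the shared tables: level `k+1` from the column levels `0..k`. [folklore] -/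
def wColStepA (n prec : ℕ) (ops : Array (Array (List (ℕ × IntervalD)))) (k : ℕ) (Us : Array (Array IntervalD)) : Array IntervalD :=
  let prods : Array (Array IntervalD) := Array.ofFn fun m : Fin (k + 1) => applyLinA n prec (pget ops m) (lget Us (k - m))
  Array.ofFn fun c : Fin n => divNat prec (rangeSumR prec (fun m => aget (lget prods m) c) (k + 1)) (k + 1)

/-- **Variational interval jets of one direction column** through the shared operator tables: levels `0..K` over the direction box `D`.
[folklore] -/
def wColLevelsA (n prec : ℕ) (ops : Array (Array (List (ℕ × IntervalD)))) (D : Array IntervalD) : ℕ → Array (Array IntervalD) :=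
  buildLevels (wColStepA n prec ops) D

/-- The MATRIX form: every direction column of `Ds` run against the same tables of the state table `Ls`. [folklore] -/
def wMatLevelsA (n prec : ℕ) (mkOp : Array IntervalD → Array (List (ℕ × IntervalD))) (Ls : Array (Array IntervalD))
    (Ds : Array (Array IntervalD)) (K : ℕ) : Array (Array (Array IntervalD)) :=
  let ops := opsOf mkOp Ls K
  Array.ofFn fun col : Fin Ds.size => wColLevelsA n prec ops (Ds.getD col #[]) K

/-- Column-step outputs have size `n`. [folklore] -/
theorem size_wColStepA (n prec : ℕ) (ops : Array (Array (List (ℕ × IntervalD)))) (k : ℕ) (Us : Array (Array IntervalD)) :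
    (wColStepA n prec ops k Us).size = n := by
  simp only [wColStepA, Array.size_ofFn]

/-- `pget` of `opsOf` below the size. [folklore] -/
theorem pget_opsOf (mkOp : Array IntervalD → Array (List (ℕ × IntervalD))) (Ls : Array (Array IntervalD)) {K m : ℕ} (hm : m < K + 1) :
    pget (opsOf mkOp Ls K) m = mkOp (lget Ls m) := by
  unfold pget opsOf
  rw [dif_pos (by rw [Array.size_ofFn]; exact hm), Array.getElem_ofFn]

section SoundA

variable {V : Type*} (rd : V → ℕ → ℝ) (Q : V → V → V) (n prec : ℕ)

/-- The linearisation `mkOp A` of a state box `A` (size `n`) encloses the symmetrised bilinear map: for `u ∈ A`, `w ∈ W` (coordinatewise below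
`n`), `Q u w + Q w u ∈ applyLinA n prec (mkOp A) W` coordinatewise. [folklore] -/
def IsLinSymEnclosureA (mkOp : Array IntervalD → Array (List (ℕ × IntervalD))) : Prop :=
  ∀ (A W : Array IntervalD) (u w : V), A.size = n → W.size = n →
    (∀ c < n, mem (rd u c) (aget A c)) → (∀ c < n, mem (rd w c) (aget W c)) →
      ∀ c < n, mem (rd (Q u w) c + rd (Q w u) c) (aget (applyLinA n prec (mkOp A) W) c)

variable {rd Q n prec}

/-- **The per-column levels form a variational jet enclosure for the symmetrised twin** read off the shared tables (structural, given that the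
tables ARE the linearisations of the state levels). [folklore] -/
theorem isVarJetEnclosureS_wColLevelsA (mkOp : Array IntervalD → Array (List (ℕ × IntervalD))) {Ls : Array (Array IntervalD)} {K : ℕ}
    (hLs : ∀ m ≤ K, (lget Ls m).size = n) {D : Array IntervalD} (hD : D.size = n) :
    IsVarJetEnclosureS (fun A W (c : Fin n) => aget (applyLinA n prec (mkOp (Array.ofFn A)) (Array.ofFn W)) c) prec K (fnLevels n Ls)
      (fnLevels n (wColLevelsA n prec (opsOf mkOp Ls K) D K)) := by
  intro k hk c x hx
  have hsz : ∀ {j : ℕ}, j ≤ K → (lget (buildLevels (wColStepA n prec (opsOf mkOp Ls K)) D K) j).size = n := fun hj =>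
    size_lget_buildLevels _ D hD (size_wColStepA n prec _) hj
  have hlev : aget (lget (wColLevelsA n prec (opsOf mkOp Ls K) D K) (k + 1)) c =
      varJetStepS (fun A W (c : Fin n) => aget (applyLinA n prec (mkOp (Array.ofFn A)) (Array.ofFn W)) c) prec (fnLevels n Ls)
        (fnLevels n (wColLevelsA n prec (opsOf mkOp Ls K) D K)) k c := by
    simp only [varJetStepS]
    unfold wColLevelsA
    rw [lget_buildLevels_of_le _ D (Nat.succ_le_of_lt hk), lget_buildLevels_succ]
    simp only [wColStepA]
    rw [aget_ofFn _ c.isLt]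
    congr 1
    refine rangeSumR_congr prec (k + 1) fun m hm => ?_
    have hm' : m ≤ K := by omega
    have hkm : k - m ≤ K := by omega
    have e2 : lget (buildLevels (wColStepA n prec (opsOf mkOp Ls K)) D k) (k - m) =
        lget (buildLevels (wColStepA n prec (opsOf mkOp Ls K)) D K) (k - m) := by
      rw [lget_buildLevels_of_le _ D hkm, lget_buildLevels_of_le _ D (Nat.sub_le k m)]
    rw [lget_ofFn _ hm]
    dsimp only
    rw [pget_opsOf mkOp Ls (by omega), e2, ofFn_fnLevels (hLs m hm'), ofFn_fnLevels (hsz hkm)]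
  show mem x (aget (lget (wColLevelsA n prec (opsOf mkOp Ls K) D K) (k + 1)) c)
  rw [hlev]; exact hx

/-- **Variational jets of one direction column through the shared linearised tables**: `rd (U y v k) c ∈ (wColLevelsA …)[k][c]` for `y` with
coordinates in `Y` and `v` with coordinates in `D`, along the state levels `jetLevelsA n QBA prec Y K`. [folklore] -/
theorem mem_varJet_of_wColLevelsA {T : V → ℕ → V} {U : V → V → ℕ → V} (hT0 : ∀ x, ∀ c < n, rd (T x 0) c = rd x c)
    (hTs : ∀ x (k : ℕ), ∀ c < n, ((k : ℝ) + 1) * rd (T x (k + 1)) c =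
      ∑ i ∈ Finset.range (k + 1), rd (Q (T x i) (T x (k - i))) c)
    (hU0 : ∀ x v, ∀ c < n, rd (U x v 0) c = rd v c)
    (hUs : ∀ x v (k : ℕ), ∀ c < n, ((k : ℝ) + 1) * rd (U x v (k + 1)) c =
      ∑ i ∈ Finset.range (k + 1), (rd (Q (T x i) (U x v (k - i))) c + rd (Q (U x v (k - i)) (T x i)) c))
    {QBA : Array IntervalD → Array IntervalD → Array IntervalD} (hQBA : IsFieldEnclosureA rd Q n QBA)
    {mkOp : Array IntervalD → Array (List (ℕ × IntervalD))} (hOp : IsLinSymEnclosureA rd Q n prec mkOp)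
    (K : ℕ) {Y D : Array IntervalD} (hY : Y.size = n) (hD : D.size = n) {y v : V}
    (hy : ∀ c < n, mem (rd y c) (aget Y c)) (hv : ∀ c < n, mem (rd v c) (aget D c)) :
    ∀ k ≤ K, ∀ c < n, mem (rd (U y v k) c)
      (aget (lget (wColLevelsA n prec (opsOf mkOp (jetLevelsA n QBA prec Y K) K) D K) k) c) := by
  have hQS : IsSymFieldEnclosure (fun (x : V) (c : Fin n) => rd x c) Q
      (fun A W (c : Fin n) => aget (applyLinA n prec (mkOp (Array.ofFn A)) (Array.ofFn W)) c) := by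
    intro A W u w hu hw c
    refine hOp (Array.ofFn A) (Array.ofFn W) u w Array.size_ofFn Array.size_ofFn ?_ ?_ c c.isLt
    · intro c' hc'; rw [aget_ofFn A hc']; exact hu ⟨c', hc'⟩
    · intro c' hc'; rw [aget_ofFn W hc']; exact hw ⟨c', hc'⟩
  have hy' : ∀ c : Fin n, mem (rd y c) (fnLevels n (jetLevelsA n QBA prec Y K) 0 c) := fun c => by
    simp only [fnLevels]; rw [lget_jetLevelsA_zero]; exact hy c c.isLt
  have hv' : ∀ c : Fin n, mem (rd v c) (fnLevels n (wColLevelsA n prec (opsOf mkOp (jetLevelsA n QBA prec Y K) K) D K) 0 c) :=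
    fun c => by simp only [fnLevels]; unfold wColLevelsA; rw [lget_buildLevels_zero]; exact hv c c.isLt
  intro k hk c hc
  exact mem_varJet_of_isVarJetEnclosureS (rd := fun (x : V) (c : Fin n) => rd x c) (Q := Q) (T := T) (U := U)
    (fun x c => hT0 x c c.isLt) (fun x k c => hTs x k c c.isLt) (fun x v c => hU0 x v c c.isLt)
    (fun x v k c => hUs x v k c c.isLt) (isFieldEnclosure_fnField hQBA) hQS (isJetEnclosure_jetLevelsA QBA prec K hY)
    (isVarJetEnclosureS_wColLevelsA mkOp (fun m hm => size_lget_jetLevelsA n QBA prec hY hm) hD) hy' hv' k hk ⟨c, hc⟩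

end SoundA

end IntervalD

end Summit.NavierStokesRegularity.NavierStokesRegularity.Theorems.TaylorModelCert
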